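import Mathlib
import HarnessLib
import Summits.NavierStokesRegularity.NavierStokesRegularity.Theorems.PoloidalWindowDoorPoloidalWindowRigidityVorticityAxisymmetric
import Summits.NavierStokesRegularity.NavierStokesRegularity.Theorems.PoloidalWindowDoorPoloidalWindowRigidityAxisymmetricMean

/-!
# Route `PoloidalWindowDoor`, crux `PoloidalWindowRigidity` (K2, stmt-NavierStokesRegularity-19708) — the stratum
# «the VORTICITY of ONE slice is axisymmetric about SOME vertical axis» is settled (moving axes included)

Cell ns-regularity-ideate, seat ns-poloidal-K2-p1 gen 3 (K2 lead; helper `--supports` the crux).  The tree's vorticity-level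
axisymmetric stratum (ns-poloidal-K2-p3, `…VorticityAxisymmetric(AnyAxis)`: `eq_zero_of_curl_axisymmetric(_translate)`) assumes the
vorticity axisymmetric about a FIXED vertical axis on EVERY slice — its proof runs the vorticity equation in time.  The jet-level
probe of this seat (memo K2P1-LOCAL-NOTES §11) shows the residue's jets collapsing onto profiles whose vorticity is axisymmetric
about a vertical axis that MOVES in time.  This file removes both restrictions with a purely kinematic argument on one slice:

* `nonflatLiouville_of_curl_axisymmetric_slice` — if for ONE `s < 0` and ONE centre `c` the vorticity of the slice in the frame
  of the axis, `curl (y ↦ v(s)(y + c))`, is axisymmetric about the `x₃`-axis, then the profile (Type-I class, poloidal) is not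
  backward-singular (indeed `≡ 0`).  Proof: by K2-p3's kinematic lemma `sub_apply_zero_isAxisymmetric_of_curl` (bounded
  incompressible `C²` slice with axisymmetric curl ⇒ the slice minus its value on the axis is axisymmetric) the translated slice
  `y ↦ v(s)(y + c)` is axisymmetric UP TO THE CONSTANT DRIFT `d = v(s)(c)`, and this seat's
  `…AxisymmetricMean.nonflatLiouville_of_axisymmetric_slice_up_to_drift` (ball average + large-scale energy decay ⇒ `d_h = 0`;
  nsreg-p6 one-slice KNSS) ends.
* `nonflatLiouville_of_curl_axisymmetric_movingAxis` — corollary for a time-dependent axis `c(s)` (any map `ℝ → ℝ³`, no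
  regularity needed): vorticity axisymmetric about `c(s) + ℝe₃` on the slices ⇒ not backward-singular (one slice suffices).

WHAT THIS IS NOT: not a claim about Navier–Stokes regularity and not the open residue `stub_residueSupercriticalNearPeak` — a
settled stratum, the transfer lemma L2′ of the proposed line «lrc-jet» (HOME/ns-poloidal-K2-p1/LINE-PROPOSAL-lrc-jet.md). [folklore]
-/

noncomputable section

-- the summit and its single sub-problem share the name (CONVENTIONS §1), as in every Theorems file
set_option linter.dupNamespace false

namespace Summit.NavierStokesRegularity.NavierStokesRegularity.Theorems.PoloidalWindowDoorPoloidalWindowRigidityVorticityAxisymmetricSlice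

open MeasureTheory Set Function Filter Topology Metric InnerProductSpace
open scoped RealInnerProductSpace InnerProductSpace
open Literature.Analysis Literature.Analysis.FluidPDE
open Summit.NavierStokesRegularity.NavierStokesRegularity.Theorems.LocalSineTubeDoorProfileAlignedWindowRigidityAncient
open Summit.NavierStokesRegularity.NavierStokesRegularity.Theorems.PoloidalWindowDoorPoloidalWindowRigidityFlat
open Summit.NavierStokesRegularity.NavierStokesRegularity.Theorems.PoloidalWindowDoorPoloidalWindowRigidityAxisymmetric
open Summit.NavierStokesRegularity.NavierStokesRegularity.Theorems.PoloidalWindowDoorPoloidalWindowRigidityVorticityAxisymmetric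
open Summit.NavierStokesRegularity.NavierStokesRegularity.Theorems.PoloidalWindowDoorPoloidalWindowRigidityAxisymmetricMean

variable {C : ℝ} {v : ℝ → EuclideanSpace ℝ (Fin 3) → EuclideanSpace ℝ (Fin 3)}

/-- **Axisymmetric VORTICITY about some vertical axis on ONE slice ⇒ not backward-singular.**  Let `v` be a profile of the
route's Type-I class, poloidal along `e₃` on every slice.  If for some `s < 0` and some centre `c` the vorticity of the translated
slice `y ↦ v(s)(y + c)` is axisymmetric about the `x₃`-axis, then `(0,0)` is not a backward singular point of `v`. -/
theorem nonflatLiouville_of_curl_axisymmetric_slice (hrate : HasTypeITimeDecay C v)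
    (hcont : ContinuousOn (uncurry v) (Iio (0 : ℝ) ×ˢ univ))
    (hmild : ∀ s t : ℝ, s < t → t < 0 → ∀ x,
      v t x = UnboundedOperators.heatExtension (v s) (t - s) x - oseenDuhamel 1 s v v t x)
    (hdiv : ∀ t < 0, VectorCalculus.IsDivFree (v t))
    (hpol : ∀ s < 0, ∀ y, ⟪curl (v s) y, EuclideanSpace.single 2 1⟫_ℝ = 0)
    {s : ℝ} (hs : s < 0) (c : EuclideanSpace ℝ (Fin 3))
    (haxi : IsAxisymmetric (curl (fun y => v s (y + c)))) :
    ¬ IsBackwardSingularPoint v 0 := by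
  -- the translated profile is in the class
  obtain ⟨hrate', hcont', hmild', hdiv'⟩ := class_translate c hrate hcont hmild hdiv
  have hbdd' := bdd_of_hasTypeITimeDecay hrate'
  have hC2 : ContDiff ℝ 2 ((fun t y => v t (y + c)) s) := (analyticOnNhd_slice hcont' hbdd' hmild' hs).contDiff
  -- kinematics on the slice: `y ↦ v(s)(y + c) − v(s)(c)` is axisymmetric
  have hax : IsAxisymmetric (fun y => (fun t y => v t (y + c)) s y - (fun t y => v t (y + c)) s 0) :=
    sub_apply_zero_isAxisymmetric_of_curl hC2 (hdiv' s hs) (fun x => hrate' s hs x) haxi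
  have hax' : IsAxisymmetric (fun y => v s (y + c) - v s c) := by
    intro θ y
    have h := hax θ y
    simpa only [zero_add] using h
  exact nonflatLiouville_of_axisymmetric_slice_up_to_drift hrate hcont hmild hdiv hpol hs c (v s c) hax'

/-- **Moving axis.**  If the vorticity of the profile is axisymmetric about the vertical axis through a centre `c(s)` depending
on the slice (any map `c : ℝ → ℝ³`; one slice would do), then the profile is not backward-singular. -/
theorem nonflatLiouville_of_curl_axisymmetric_movingAxis (hrate : HasTypeITimeDecay C v)
    (hcont : ContinuousOn (uncurry v) (Iio (0 : ℝ) ×ˢ univ))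
    (hmild : ∀ s t : ℝ, s < t → t < 0 → ∀ x,
      v t x = UnboundedOperators.heatExtension (v s) (t - s) x - oseenDuhamel 1 s v v t x)
    (hdiv : ∀ t < 0, VectorCalculus.IsDivFree (v t))
    (hpol : ∀ s < 0, ∀ y, ⟪curl (v s) y, EuclideanSpace.single 2 1⟫_ℝ = 0)
    (c : ℝ → EuclideanSpace ℝ (Fin 3))
    (haxi : ∀ s < 0, IsAxisymmetric (curl (fun y => v s (y + c s)))) :
    ¬ IsBackwardSingularPoint v 0 :=
  nonflatLiouville_of_curl_axisymmetric_slice hrate hcont hmild hdiv hpol (by norm_num : (-1 : ℝ) < 0) (c (-1))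
    (haxi (-1) (by norm_num))

end Summit.NavierStokesRegularity.NavierStokesRegularity.Theorems.PoloidalWindowDoorPoloidalWindowRigidityVorticityAxisymmetricSlice

end
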